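import Summits.QuantumFields.YangMills.Theorems.LuscherReductionOneSiteLevelsGnPotential

/-!
# Smoothness and gradient bounds for the chart density × magnetic factor `h = (Π c_i²) · e^{−4B·gnPot}`
# (support module for the registered stub `stub_absLower` of crux `OneSiteLevels`, route `LuscherReduction`,
# item stmt-QuantumFields-20007; fleet seat prover ym-luscher-20007-p2)

The quasimode Rayleigh computation applies the flat Gaussian form bound (`gaussForm_ge`) to `Φ = G · h`, where `G` is a cut-off
span of eigenfunctions and `h(y) = gnW μ y · gnMag B μ y`, `gnW = Π_i c_i²` (chart density up to constants), `gnMag = e^{−4B·gnPot}`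
(magnetic Boltzmann factor of the chart configuration).  This costs `‖∇Φ‖²`, hence pointwise bounds on the partials of `h`.
Proved here, by one-variable calculus along the coordinate lines `t ↦ y + t e_p`:

* `contDiff_gnH`: `h` is smooth;  `gnH_pos`, `gnH_le_one`;
* `abs_pderiv_gnH_le`: `|∂_p h(y)| ≤ gnLip B μ y := 12 μ²‖y‖ + 36 B μ⁴ (μ²‖y‖⁵ + 2‖y‖³)` for every coordinate `p` (`B ≥ 0`).

With `μ = λ_b/2`, `Bλ_b³ = 2` this is `O(λ_b)(‖y‖ + ‖y‖³ + ‖y‖⁵)`, so `∫ G² ‖∇h‖² = O(λ_b²)` against exponentially decaying `G`.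

## WHAT THIS IS NOT
Calculus only; NOT the stub, NOT THE CLAY GAP.  Sorry-free, no named fact.
-/

set_option autoImplicit false

noncomputable section

open MeasureTheory Filter Topology Real
open scoped Matrix
open Literature.MathematicalPhysics.QuantumFieldTheory
open Literature.MathematicalPhysics.QuantumLattice
open Literature.Analysis.OperatorTheory.YMMatrixModel

namespace Summit.QuantumFields.YangMills.Theorems.FemtoTransferGap

/-! ### §1. The weight, the magnetic factor, smoothness -/

/-- The block inner products `y_i · y_j`. [folklore] -/
def dotB (i j : Fin 3) (y : ZM) : ℝ := colourVec y i ⬝ᵥ colourVec y j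

/-- `csq i = dotB i i`. [folklore] -/
theorem csq_eq_dotB (i : Fin 3) (y : ZM) : csq i y = dotB i i y := rfl

/-- Lagrange: `|y_i × y_j|² = |y_i|²|y_j|² − (y_i·y_j)²`. [folklore] -/
theorem crossSq_eq_lagrange (i j : Fin 3) (y : ZM) : crossSq i j y = csq i y * csq j y - dotB i j y ^ 2 := by
  rw [crossSq, cross_dot_cross, csq, csq, dotB, dotProduct_comm (colourVec y j) (colourVec y i)]
  ring

/-- Coordinates are smooth. [folklore] -/
theorem contDiff_coord {n : WithTop ℕ∞} (p : Fin 3 × Fin 3) : ContDiff ℝ n fun y : ZM => y p :=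
  (EuclideanSpace.proj (𝕜 := ℝ) p).contDiff

/-- `dotB i j` is smooth (a polynomial). [folklore] -/
theorem contDiff_dotB {n : WithTop ℕ∞} (i j : Fin 3) : ContDiff ℝ n (dotB i j) := by
  unfold dotB dotProduct colourVec
  exact ContDiff.sum fun a _ => (contDiff_coord (i, a)).mul (contDiff_coord (j, a))

/-- `csq i` is smooth. [folklore] -/
theorem contDiff_csq {n : WithTop ℕ∞} (i : Fin 3) : ContDiff ℝ n (csq i) := contDiff_dotB i i

/-- `crossSq i j` is smooth. [folklore] -/
theorem contDiff_crossSq {n : WithTop ℕ∞} (i j : Fin 3) : ContDiff ℝ n (crossSq i j) := by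
  have e : crossSq i j = fun y => csq i y * csq j y - dotB i j y ^ 2 := funext (crossSq_eq_lagrange i j)
  rw [e]
  exact ((contDiff_csq i).mul (contDiff_csq j)).sub ((contDiff_dotB i j).pow 2)

/-- `gnC μ · i` is smooth. [folklore] -/
theorem contDiff_gnC {n : WithTop ℕ∞} (μ : ℝ) (i : Fin 3) : ContDiff ℝ n fun y => gnC μ y i := by
  unfold gnC
  refine ContDiff.inv (contDiff_const.add (contDiff_const.mul (contDiff_csq i))) fun y => ?_
  have := csq_nonneg i y; positivity

/-- `gnPot μ` is smooth. [folklore] -/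
theorem contDiff_gnPot {n : WithTop ℕ∞} (μ : ℝ) : ContDiff ℝ n (gnPot μ) := by
  unfold gnPot
  refine contDiff_const.mul (ContDiff.sum fun i _ => ContDiff.sum fun j _ => ?_)
  exact (contDiff_const.mul ((contDiff_gnC μ i).mul (contDiff_gnC μ j))).mul (contDiff_crossSq i j)

/-- The chart weight `gnW μ y = Π_i c_i²`. [folklore] -/
def gnW (μ : ℝ) (y : ZM) : ℝ := ∏ i : Fin 3, gnC μ y i ^ 2

/-- The magnetic Boltzmann factor of the chart configuration, `gnMag B μ y = e^{−4B·gnPot μ y} = e^{−(B/2)S(gnChart μ σ y)}`.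
[folklore] -/
def gnMag (B μ : ℝ) (y : ZM) : ℝ := Real.exp (-(4 * B * gnPot μ y))

/-- `h = gnW · gnMag`. [folklore] -/
def gnH (B μ : ℝ) (y : ZM) : ℝ := gnW μ y * gnMag B μ y

/-- `gnMag` is the magnetic factor: `e^{−(B/2)·S(gnChart μ σ y)} = gnMag B μ y`. [folklore] -/
theorem exp_neg_half_wilsonAction_gnChart (B μ : ℝ) (σ : Fin 3 → Bool) (y : ZM) :
    Real.exp (-(B / 2) * wilsonAction su2Rep (gnChart μ σ y)) = gnMag B μ y := by
  rw [wilsonAction_gnChart, gnMag]; congr 1; ring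

/-- `gnW` is smooth. [folklore] -/
theorem contDiff_gnW {n : WithTop ℕ∞} (μ : ℝ) : ContDiff ℝ n (gnW μ) := by
  unfold gnW
  exact contDiff_prod fun i _ => (contDiff_gnC μ i).pow 2

/-- `gnMag` is smooth. [folklore] -/
theorem contDiff_gnMag {n : WithTop ℕ∞} (B μ : ℝ) : ContDiff ℝ n (gnMag B μ) := by
  unfold gnMag
  exact Real.contDiff_exp.comp ((contDiff_const.mul (contDiff_gnPot μ)).neg)

/-- `h` is smooth. [folklore] -/
theorem contDiff_gnH {n : WithTop ℕ∞} (B μ : ℝ) : ContDiff ℝ n (gnH B μ) :=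
  (contDiff_gnW μ).mul (contDiff_gnMag B μ)

/-- `0 < gnW ≤ 1`. [folklore] -/
theorem gnW_pos (μ : ℝ) (y : ZM) : 0 < gnW μ y := Finset.prod_pos fun i _ => pow_pos (gnC_pos μ y i) 2

/-- `gnW ≤ 1`. [folklore] -/
theorem gnW_le_one (μ : ℝ) (y : ZM) : gnW μ y ≤ 1 := prod_gnC_sq_le_one μ y

/-- `0 < gnMag ≤ 1` for `B ≥ 0`. [folklore] -/
theorem gnMag_pos (B μ : ℝ) (y : ZM) : 0 < gnMag B μ y := Real.exp_pos _

/-- `gnMag ≤ 1` for `B ≥ 0`. [folklore] -/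
theorem gnMag_le_one {B : ℝ} (hB : 0 ≤ B) (μ : ℝ) (y : ZM) : gnMag B μ y ≤ 1 := by
  unfold gnMag
  rw [Real.exp_le_one_iff]
  have := gnPot_nonneg μ y
  nlinarith

/-- `0 < h ≤ 1` for `B ≥ 0`. [folklore] -/
theorem gnH_pos (B μ : ℝ) (y : ZM) : 0 < gnH B μ y := mul_pos (gnW_pos μ y) (gnMag_pos B μ y)

/-- `h ≤ 1` for `B ≥ 0`. [folklore] -/
theorem gnH_le_one {B : ℝ} (hB : 0 ≤ B) (μ : ℝ) (y : ZM) : gnH B μ y ≤ 1 := by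
  unfold gnH
  have h1 := gnW_le_one μ y; have h2 := gnMag_le_one hB μ y; have h3 := gnW_pos μ y; have h4 := gnMag_pos B μ y
  nlinarith

/-- `gnMag B μ y ≥ 1 − λ V(y)` whenever `8Bμ⁴ ≤ λ`: the magnetic factor squared, `gnMag² = e^{−8B gnPot} ≥ 1 − 8Bμ⁴V`. [folklore] -/
theorem one_sub_le_gnMag_sq {B : ℝ} (hB : 0 ≤ B) (μ : ℝ) (y : ZM) :
    1 - 8 * B * μ ^ 4 * luscherPotential y ≤ gnMag B μ y ^ 2 := by
  unfold gnMag
  rw [← Real.exp_nat_mul]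
  have h1 : -(8 * B * gnPot μ y) + 1 ≤ Real.exp ((2:ℕ) * -(4 * B * gnPot μ y)) := by
    have h := Real.add_one_le_exp (-(8 * B * gnPot μ y))
    have e : ((2:ℕ) : ℝ) * -(4 * B * gnPot μ y) = -(8 * B * gnPot μ y) := by push_cast; ring
    rwa [e]
  have h2 : 8 * B * gnPot μ y ≤ 8 * B * μ ^ 4 * luscherPotential y := by
    have := gnPot_le μ y; nlinarith
  linarith

/-! ### §2. Line derivatives of the building blocks along `e_p`, `p = (i₀, a₀)` -/

section LineDeriv

variable (y : ZM) (p : Fin 3 × Fin 3)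

/-- `|y_q| ≤ ‖y‖` for a coordinate `q`. [folklore] -/
theorem abs_coord_le_norm (q : Fin 3 × Fin 3) : |y q| ≤ ‖y‖ := by
  have h := EuclideanSpace.real_norm_sq_eq y
  have h1 : y q ^ 2 ≤ ‖y‖ ^ 2 := by
    rw [h]; exact Finset.single_le_sum (fun r _ => sq_nonneg (y r)) (Finset.mem_univ q)
  exact abs_le_of_sq_le_sq' h1 (norm_nonneg _) |>.2 |> fun h2 => abs_le.2 ⟨(abs_le_of_sq_le_sq' h1 (norm_nonneg _)).1, h2⟩

/-- `csq i y ≤ ‖y‖²`. [folklore] -/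
theorem csq_le_norm_sq (i : Fin 3) : csq i y ≤ ‖y‖ ^ 2 := by
  rw [norm_sq_eq_sum_csq]; exact Finset.single_le_sum (fun j _ => csq_nonneg j y) (Finset.mem_univ i)

/-- `|y_i · y_j| ≤ ‖y‖²`. [folklore] -/
theorem abs_dotB_le (i j : Fin 3) : |dotB i j y| ≤ ‖y‖ ^ 2 := by
  have hcs : dotB i j y ^ 2 ≤ csq i y * csq j y := by
    rw [dotB, csq, csq]
    have := Finset.sum_mul_sq_le_sq_mul_sq Finset.univ (colourVec y i) (colourVec y j)
    simpa [dotProduct, sq] using this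
  have h1 := csq_le_norm_sq y i; have h2 := csq_le_norm_sq y j
  have h3 := csq_nonneg i y; have h4 := csq_nonneg j y
  have : dotB i j y ^ 2 ≤ (‖y‖ ^ 2) ^ 2 := hcs.trans (by nlinarith)
  exact abs_le_of_sq_le_sq' this (by positivity) |> fun h => abs_le.2 h

/-- The block inner product along the line: `(y+te_p)_i · (y+te_p)_j` is a quadratic polynomial in `t`. [folklore] -/
theorem dotB_line (i j : Fin 3) (t : ℝ) :
    dotB i j (y + t • unitDir p) = dotB i j y
      + t * ((if i = p.1 then y (j, p.2) else 0) + (if j = p.1 then y (i, p.2) else 0))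
      + (if i = p.1 ∧ j = p.1 then t ^ 2 else 0) := by
  obtain ⟨i₀, a₀⟩ := p
  simp only
  unfold dotB
  by_cases hi : i = i₀ <;> by_cases hj : j = i₀
  · subst hi; subst hj
    rw [colourVec_add_smul_unitDir_self]
    simp [dotProduct_add, add_dotProduct, dotProduct_smul, smul_dotProduct, colourVec]
    ring
  · subst hi
    rw [colourVec_add_smul_unitDir_self, colourVec_add_smul_unitDir_of_ne y t hj]
    simp [add_dotProduct, smul_dotProduct, hj, colourVec]
  · subst hj
    rw [colourVec_add_smul_unitDir_self, colourVec_add_smul_unitDir_of_ne y t hi]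
    simp [dotProduct_add, dotProduct_smul, hi, colourVec]
  · rw [colourVec_add_smul_unitDir_of_ne y t hi, colourVec_add_smul_unitDir_of_ne y t hj]
    simp [hi, hj]

/-- The derivative of `t ↦ (y+te_p)_i·(y+te_p)_j` at `0`. [folklore] -/
def dotB' (i j : Fin 3) : ℝ := (if i = p.1 then y (j, p.2) else 0) + (if j = p.1 then y (i, p.2) else 0)

/-- Derivative of the block inner product along `e_p` at `t = 0`. [folklore] -/
theorem hasDerivAt_dotB_line (i j : Fin 3) :
    HasDerivAt (fun t : ℝ => dotB i j (y + t • unitDir p)) (dotB' y p i j) 0 := by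
  have e : (fun t : ℝ => dotB i j (y + t • unitDir p)) = fun t => dotB i j y + t * dotB' y p i j
      + (if i = p.1 ∧ j = p.1 then t ^ 2 else 0) := funext fun t => by rw [dotB_line]; rfl
  rw [e]
  have h1 : HasDerivAt (fun t : ℝ => dotB i j y + t * dotB' y p i j) (dotB' y p i j) 0 := by
    simpa using ((hasDerivAt_id (0:ℝ)).mul_const (dotB' y p i j)).const_add (dotB i j y)
  have h2 : HasDerivAt (fun t : ℝ => if i = p.1 ∧ j = p.1 then t ^ 2 else 0) 0 0 := by
    split_ifs
    · simpa using hasDerivAt_pow 2 (0:ℝ)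
    · exact hasDerivAt_const _ _
  have h := h1.add h2
  rw [add_zero] at h
  exact h

/-- `|dotB'| ≤ 2‖y‖`. [folklore] -/
theorem abs_dotB'_le (i j : Fin 3) : |dotB' y p i j| ≤ 2 * ‖y‖ := by
  unfold dotB'
  have h1 : |(if i = p.1 then y (j, p.2) else 0)| ≤ ‖y‖ := by
    split_ifs
    · exact abs_coord_le_norm y _
    · simp
  have h2 : |(if j = p.1 then y (i, p.2) else 0)| ≤ ‖y‖ := by
    split_ifs
    · exact abs_coord_le_norm y _
    · simp
  calc _ ≤ |(if i = p.1 then y (j, p.2) else 0)| + |(if j = p.1 then y (i, p.2) else 0)| := abs_add_le _ _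
    _ ≤ 2 * ‖y‖ := by linarith

/-- The derivative of `crossSq i j` along `e_p` at `y`. [folklore] -/
def crossSq' (i j : Fin 3) : ℝ :=
  dotB' y p i i * csq j y + csq i y * dotB' y p j j - 2 * dotB i j y * dotB' y p i j

/-- Derivative of the transverse square along `e_p` at `t = 0`. [folklore] -/
theorem hasDerivAt_crossSq_line (i j : Fin 3) :
    HasDerivAt (fun t : ℝ => crossSq i j (y + t • unitDir p)) (crossSq' y p i j) 0 := by
  have e : (fun t : ℝ => crossSq i j (y + t • unitDir p)) =
      fun t => dotB i i (y + t • unitDir p) * dotB j j (y + t • unitDir p) - dotB i j (y + t • unitDir p) ^ 2 :=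
    funext fun t => by rw [crossSq_eq_lagrange]; rfl
  rw [e]
  have h := ((hasDerivAt_dotB_line y p i i).mul (hasDerivAt_dotB_line y p j j)).sub ((hasDerivAt_dotB_line y p i j).pow 2)
  refine h.congr_deriv ?_
  simp only [crossSq', csq_eq_dotB, zero_smul, add_zero, Nat.cast_ofNat]
  ring

/-- `|crossSq'| ≤ 8‖y‖³`. [folklore] -/
theorem abs_crossSq'_le (i j : Fin 3) : |crossSq' y p i j| ≤ 8 * ‖y‖ ^ 3 := by
  unfold crossSq'
  have h1 := abs_dotB'_le y p i i; have h2 := abs_dotB'_le y p j j; have h3 := abs_dotB'_le y p i j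
  have h4 := csq_le_norm_sq y i; have h5 := csq_le_norm_sq y j; have h6 := abs_dotB_le y i j
  have h7 := csq_nonneg i y; have h8 := csq_nonneg j y; have hn := norm_nonneg y
  have e1 : |dotB' y p i i * csq j y| ≤ 2 * ‖y‖ * ‖y‖ ^ 2 := by
    rw [abs_mul, abs_of_nonneg h8]; exact mul_le_mul h1 h5 h8 (by positivity)
  have e2 : |csq i y * dotB' y p j j| ≤ ‖y‖ ^ 2 * (2 * ‖y‖) := by
    rw [abs_mul, abs_of_nonneg h7]; exact mul_le_mul h4 h2 (abs_nonneg _) (by positivity)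
  have e3 : |2 * dotB i j y * dotB' y p i j| ≤ 2 * ‖y‖ ^ 2 * (2 * ‖y‖) := by
    rw [abs_mul, abs_mul, abs_two]
    exact mul_le_mul (mul_le_mul_of_nonneg_left h6 (by norm_num)) h3 (abs_nonneg _) (by positivity)
  calc |dotB' y p i i * csq j y + csq i y * dotB' y p j j - 2 * dotB i j y * dotB' y p i j|
      ≤ |dotB' y p i i * csq j y + csq i y * dotB' y p j j| + |2 * dotB i j y * dotB' y p i j| := abs_sub _ _
    _ ≤ |dotB' y p i i * csq j y| + |csq i y * dotB' y p j j| + |2 * dotB i j y * dotB' y p i j| := by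
        linarith [abs_add_le (dotB' y p i i * csq j y) (csq i y * dotB' y p j j)]
    _ ≤ 2 * ‖y‖ * ‖y‖ ^ 2 + ‖y‖ ^ 2 * (2 * ‖y‖) + 2 * ‖y‖ ^ 2 * (2 * ‖y‖) := by linarith
    _ = 8 * ‖y‖ ^ 3 := by ring

/-- The derivative of `c_i` along `e_p`: `−μ² c_i² · (csq_i)'`. [folklore] -/
def gnC' (μ : ℝ) (i : Fin 3) : ℝ := -(μ ^ 2 * dotB' y p i i) * gnC μ y i ^ 2

/-- Derivative of the chart weight `c_i` along `e_p` at `t = 0`. [folklore] -/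
theorem hasDerivAt_gnC_line (μ : ℝ) (i : Fin 3) :
    HasDerivAt (fun t : ℝ => gnC μ (y + t • unitDir p) i) (gnC' y p μ i) 0 := by
  unfold gnC
  have hpos : ∀ t : ℝ, (1 + μ ^ 2 * csq i (y + t • unitDir p)) ≠ 0 := fun t => by
    have := csq_nonneg i (y + t • unitDir p); positivity
  have h1 : HasDerivAt (fun t : ℝ => 1 + μ ^ 2 * csq i (y + t • unitDir p)) (μ ^ 2 * dotB' y p i i) 0 := by
    have h := ((hasDerivAt_dotB_line y p i i).const_mul (μ ^ 2)).const_add 1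
    simpa [csq_eq_dotB] using h
  have h := h1.inv (hpos 0)
  refine h.congr_deriv ?_
  simp only [gnC', gnC, zero_smul, add_zero, csq_eq_dotB]
  rw [div_eq_mul_inv, ← inv_pow, neg_mul]

/-- `|c_i'| ≤ 2μ²‖y‖`. [folklore] -/
theorem abs_gnC'_le (μ : ℝ) (i : Fin 3) : |gnC' y p μ i| ≤ 2 * μ ^ 2 * ‖y‖ := by
  unfold gnC'
  rw [abs_mul, abs_neg, abs_mul, abs_of_nonneg (sq_nonneg μ), abs_of_nonneg (sq_nonneg (gnC μ y i))]
  have h1 := abs_dotB'_le y p i i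
  have h2 : gnC μ y i ^ 2 ≤ 1 := by
    have := gnC_le_one μ y i; have := gnC_pos μ y i; nlinarith
  calc μ ^ 2 * |dotB' y p i i| * gnC μ y i ^ 2 ≤ μ ^ 2 * (2 * ‖y‖) * 1 :=
        mul_le_mul (mul_le_mul_of_nonneg_left h1 (sq_nonneg μ)) h2 (sq_nonneg _) (by positivity)
    _ = 2 * μ ^ 2 * ‖y‖ := by ring

/-- The derivative of one summand `μ⁴ c_i c_j |y_i × y_j|²` of `gnPot` along `e_p`. [folklore] -/
def gnTerm' (μ : ℝ) (i j : Fin 3) : ℝ :=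
  μ ^ 4 * ((gnC' y p μ i * gnC μ y j + gnC μ y i * gnC' y p μ j) * crossSq i j y
    + gnC μ y i * gnC μ y j * crossSq' y p i j)

/-- Derivative of one summand of `gnPot` along `e_p` at `t = 0`. [folklore] -/
theorem hasDerivAt_gnTerm_line (μ : ℝ) (i j : Fin 3) :
    HasDerivAt (fun t : ℝ => μ ^ 4 * (gnC μ (y + t • unitDir p) i * gnC μ (y + t • unitDir p) j) *
      crossSq i j (y + t • unitDir p)) (gnTerm' y p μ i j) 0 := by
  have h := (((hasDerivAt_gnC_line y p μ i).mul (hasDerivAt_gnC_line y p μ j)).const_mul (μ ^ 4)).mul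
    (hasDerivAt_crossSq_line y p i j)
  refine h.congr_deriv ?_
  simp only [gnTerm', zero_smul, add_zero, Pi.mul_apply]
  ring

/-- `|gnTerm'| ≤ μ⁴(4μ²‖y‖⁵ + 8‖y‖³)`. [folklore] -/
theorem abs_gnTerm'_le (μ : ℝ) (i j : Fin 3) : |gnTerm' y p μ i j| ≤ μ ^ 4 * (4 * μ ^ 2 * ‖y‖ ^ 5 + 8 * ‖y‖ ^ 3) := by
  unfold gnTerm'
  have hci := gnC_le_one μ y i; have hcj := gnC_le_one μ y j
  have hci0 := (gnC_pos μ y i).le; have hcj0 := (gnC_pos μ y j).le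
  have hP : crossSq i j y ≤ ‖y‖ ^ 4 := by
    rw [crossSq_eq_lagrange]
    have := csq_le_norm_sq y i; have := csq_le_norm_sq y j; have := csq_nonneg i y; have := csq_nonneg j y
    nlinarith [sq_nonneg (dotB i j y)]
  have hP0 := crossSq_nonneg i j y
  have h1 := abs_gnC'_le y p μ i; have h2 := abs_gnC'_le y p μ j; have h3 := abs_crossSq'_le y p i j
  have hn := norm_nonneg y
  rw [abs_mul, abs_of_nonneg (by positivity : (0:ℝ) ≤ μ ^ 4)]
  refine mul_le_mul_of_nonneg_left ?_ (by positivity)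
  have e1 : |gnC' y p μ i * gnC μ y j| ≤ 2 * μ ^ 2 * ‖y‖ := by
    rw [abs_mul, abs_of_nonneg hcj0]; nlinarith [abs_nonneg (gnC' y p μ i)]
  have e2 : |gnC μ y i * gnC' y p μ j| ≤ 2 * μ ^ 2 * ‖y‖ := by
    rw [abs_mul, abs_of_nonneg hci0]; nlinarith [abs_nonneg (gnC' y p μ j)]
  have e3 : |(gnC' y p μ i * gnC μ y j + gnC μ y i * gnC' y p μ j) * crossSq i j y| ≤ 4 * μ ^ 2 * ‖y‖ * ‖y‖ ^ 4 := by
    rw [abs_mul, abs_of_nonneg hP0]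
    exact mul_le_mul ((abs_add_le _ _).trans (by linarith)) hP hP0 (by positivity)
  have e4 : |gnC μ y i * gnC μ y j * crossSq' y p i j| ≤ 8 * ‖y‖ ^ 3 := by
    rw [abs_mul, abs_mul, abs_of_nonneg hci0, abs_of_nonneg hcj0]
    calc gnC μ y i * gnC μ y j * |crossSq' y p i j| ≤ 1 * 1 * (8 * ‖y‖ ^ 3) :=
          mul_le_mul (mul_le_mul hci hcj hcj0 zero_le_one) h3 (abs_nonneg _) (by norm_num)
      _ = 8 * ‖y‖ ^ 3 := by ring
  calc _ ≤ |(gnC' y p μ i * gnC μ y j + gnC μ y i * gnC' y p μ j) * crossSq i j y| + |gnC μ y i * gnC μ y j * crossSq' y p i j| :=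
        abs_add_le _ _
    _ ≤ 4 * μ ^ 2 * ‖y‖ * ‖y‖ ^ 4 + 8 * ‖y‖ ^ 3 := add_le_add e3 e4
    _ = 4 * μ ^ 2 * ‖y‖ ^ 5 + 8 * ‖y‖ ^ 3 := by ring

/-- The derivative of `gnPot μ` along `e_p` at `y`. [folklore] -/
def gnPot' (μ : ℝ) : ℝ := (1 / 4 : ℝ) * ∑ i : Fin 3, ∑ j : Fin 3, gnTerm' y p μ i j

/-- Derivative of `gnPot` along `e_p` at `t = 0`. [folklore] -/
theorem hasDerivAt_gnPot_line (μ : ℝ) : HasDerivAt (fun t : ℝ => gnPot μ (y + t • unitDir p)) (gnPot' y p μ) 0 := by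
  unfold gnPot gnPot'
  refine HasDerivAt.const_mul _ (HasDerivAt.fun_sum fun i _ => HasDerivAt.fun_sum fun j _ => ?_)
  exact hasDerivAt_gnTerm_line y p μ i j

/-- **`|∂_p gnPot| ≤ 9μ⁴(μ²‖y‖⁵ + 2‖y‖³)`**. [folklore] -/
theorem abs_gnPot'_le (μ : ℝ) : |gnPot' y p μ| ≤ 9 * μ ^ 4 * (μ ^ 2 * ‖y‖ ^ 5 + 2 * ‖y‖ ^ 3) := by
  unfold gnPot'
  rw [abs_mul, abs_of_nonneg (by norm_num : (0:ℝ) ≤ 1 / 4)]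
  have h : |∑ i : Fin 3, ∑ j : Fin 3, gnTerm' y p μ i j| ≤ ∑ _i : Fin 3, ∑ _j : Fin 3, μ ^ 4 * (4 * μ ^ 2 * ‖y‖ ^ 5 + 8 * ‖y‖ ^ 3) :=
    (Finset.abs_sum_le_sum_abs _ _).trans (Finset.sum_le_sum fun i _ =>
      (Finset.abs_sum_le_sum_abs _ _).trans (Finset.sum_le_sum fun j _ => abs_gnTerm'_le y p μ i j))
  rw [Finset.sum_const, Finset.sum_const, Finset.card_univ, Fintype.card_fin] at h
  simp only [nsmul_eq_mul, Nat.cast_ofNat] at h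
  linarith

end LineDeriv

end Summit.QuantumFields.YangMills.Theorems.FemtoTransferGap

end
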